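import Mathlib
import Summits.KontsevichZagierPeriods.Zeta5Search.CellKitRays
import HarnessLib

/-!
# ζ(5) search — CELL KIT, part 5: point values on a linear ray and the centre term, in the form the generated atlases use

Cell `pub-zeta5` (HONEST FRAMING: systematic search; no irrationality claim unless certified), P1 prover seat generation 7.
Value-level forms of the staircase of `CellKitRays` (`netExp (bLin a e n) q = v` from the bracket of `q`, with the value `v`
supplied by the caller and checked by `v + k = 1`), and the case description of the odd-centre term of the class exponent
(`centreTerm_spec`).  These are the only kit facts the machine-generated cell atlases
(`AtlasCell*.lean`) invoke before `omega`.  Combinatorics only; nothing about irrationality.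
-/

noncomputable section

open Finset

namespace Summit.KontsevichZagierPeriods.Zeta5Search.CellKit

open Summit.KontsevichZagierPeriods.Zeta5Search.ClusterValuation (netExp classSet CentreIn classExp)
open Summit.KontsevichZagierPeriods.Zeta5Search.LevelClass

/-! ### §1 Point values on a linear ray -/

/-- Below all blocks: net exponent `1`. -/
theorem netExp_lowV {a e n q : ℕ} (h : q < a) : netExp (bLin a e n) q = 1 := by
  rw [netExp_bLin_of_ne (by omega), depL_low h]; norm_num

/-- Above all blocks: net exponent `1`. -/
theorem netExp_highV {a e n q : ℕ} (h : a + 12 * n + e < q) : netExp (bLin a e n) q = 1 := by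
  rw [netExp_bLin_of_ne (by omega), depL_high h]; norm_num

/-- Lower staircase: net exponent `1 − k` on `[a + (k−1)n, a + kn)`, `1 ≤ k ≤ 6`. -/
theorem netExp_lowerV {a e n q k : ℕ} (hk1 : 1 ≤ k) (hk : k ≤ 6) (h1 : a + (k - 1) * n ≤ q) (h2 : q < a + k * n)
    {v : ℤ} (hv : v + k = 1) : netExp (bLin a e n) q = v := by
  have hkn : k * n ≤ 6 * n := Nat.mul_le_mul_right n hk
  rw [netExp_bLin_of_ne (by omega), depL_lower hk1 hk h1 h2]; omega

/-- The well, off the centre: net exponent `−6`. -/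
theorem netExp_wellV {a e n q : ℕ} (h1 : a + 6 * n ≤ q) (h2 : q ≤ a + 6 * n + e) (hc : 2 * q ≠ 2 * a + 12 * n + e) :
    netExp (bLin a e n) q = -6 := by
  rw [netExp_bLin_of_ne hc, depL_well h1 h2]; norm_num

/-- The even centre: net exponent `−5`. -/
theorem netExp_centreV {a e n q : ℕ} (hc : 2 * q = 2 * a + 12 * n + e) : netExp (bLin a e n) q = -5 := by
  rw [netExp_bLin_centre hc, depL_well (by omega) (by omega)]; norm_num

/-- Upper staircase: net exponent `1 − k` on `(a + (12−k)n + e, a + (13−k)n + e]`, `1 ≤ k ≤ 6`. -/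
theorem netExp_upperV {a e n q k : ℕ} (hk1 : 1 ≤ k) (hk : k ≤ 6) (h1 : a + (12 - k) * n + e < q)
    (h2 : q ≤ a + (13 - k) * n + e) {v : ℤ} (hv : v + k = 1) : netExp (bLin a e n) q = v := by
  have hkn : 6 * n ≤ (12 - k) * n := Nat.mul_le_mul_right n (by omega)
  rw [netExp_bLin_of_ne (by omega), depL_upper hk1 hk h1 h2]; omega

/-! ### §2 The centre term of the class exponent -/

/-- Case description of the odd-centre term `[b₀ odd ∧ centre ∈ class]` of `classExp` (no new definition: the `if` is written out). -/
theorem centreTerm_spec (b : ℕ → ℤ) (p x : ℕ) :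
    ((if ¬ (2 : ℤ) ∣ b 0 ∧ CentreIn b p x then (1 : ℤ) else 0) = 1 ∧ ¬ (2 : ℤ) ∣ b 0 ∧ CentreIn b p x) ∨
    ((if ¬ (2 : ℤ) ∣ b 0 ∧ CentreIn b p x then (1 : ℤ) else 0) = 0 ∧ ((2 : ℤ) ∣ b 0 ∨ ¬ CentreIn b p x)) := by
  by_cases h2 : (2 : ℤ) ∣ b 0
  · right; rw [if_neg (fun h => h.1 h2)]; exact ⟨rfl, Or.inl h2⟩
  · by_cases hc : CentreIn b p x
    · left; rw [if_pos ⟨h2, hc⟩]; exact ⟨rfl, h2, hc⟩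
    · right; rw [if_neg (fun h => hc h.2)]; exact ⟨rfl, Or.inr hc⟩

end Summit.KontsevichZagierPeriods.Zeta5Search.CellKit

end
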